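import Literature.NumberTheory.Automorphic.UnitaryGroupSingularTermLogForm
import Literature.NumberTheory.Automorphic.UnitaryGroupSingularTruncatedTraceClassBracket
import Literature.NumberTheory.Automorphic.IdeleClassIntegration
import HarnessLib

/-!
# The singular class of the CM unitary group `U(3)`: `J^T_{i♭}(f) = 𝔄 · log T + 𝔅` for `T ≫ 1`
(Rogawski, *Automorphic Representations of Unitary Groups in Three Variables* (1990), §7.2 Prop. 7.2.1–7.2.2, pp. 91–95.)

Topic `NumberTheory/Automorphic`; namespace `Literature.NumberTheory.Automorphic.UnitaryGroup`. THEOREMS ONLY over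
accepted tree modules: no definition, no named fact, no instance, no notation, no `sorry`. Row (L5-iii-c) «PROP. 7.2.2
EVALUATION at the singular class» of the T1-qs LAW 5 road (`Cruxes/H413/Lines/F0_T1InnerFormTraceIdentity.lean`) — THE
PER-CLASS HEAD in the currency of the (σ-ii) finset closer: composition of
★ F0P3a-p02 `truncatedTraceClass_singular_eq_integral_add_mul_integral_singularBracket_cm` (the `X`-side unfolding
`J^T_{i♭}(f) = ∫_X Σ'_{[γ₀]} + c · ∫_G β • b_T[f] dν_G`, `T > T₀`) with ★ A-p14
`exists_integral_weight_smul_singularBracket_eq_mul_log_add` (the `G(𝔸)`-side value `∫_G β • b_T[f] dν_G = 𝔄' log T + 𝔅'`),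
all auxiliary Haar measures, the covering weights `β`, `w_T`, the idele class domain and the centre measure
`μ_Y := θ_* μ_A` CHOSEN INSIDE the proof; the non-square hypothesis of ★ `singularTorusStage_eq_linear` is discharged
(`θ₀ = δ²` with `c δ = -δ ≠ 0` is never a square in `F`, `not_isSquare_of_conj_eq_neg`).

* `not_isSquare_of_conj_eq_neg` — for a quadratic datum `(F, E, c)`, `c δ = -δ`, `δ ≠ 0`, `δ² = θ₀ ∈ F` ⟹ `θ₀` is not a
  square in `F`.
* HEAD **`truncatedTraceClass_singular_eq_mul_log_add_cm`**: for a CM field `L`, the singular base point `γ₀ = ι(d(a,b,a))`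
  (`a ≠ b` of norm one), a test function `f` with integrable `[γ₀]`-orbital series (`hS`, ★ (b1)), and a trace-zero generator
  `δ` (`δ̄ = -δ ≠ 0`, `δ² = θ₀ ∈ 𝓞_F ∖ 0`): there are `𝔄 𝔅 ∈ ℂ` and `T₀` with
  `truncatedTraceClass μ ν 𝓕 T cl♭ i♭ f = 𝔄 · log T + 𝔅` for all `T > T₀`.

## References
* J. D. Rogawski, *Automorphic Representations of Unitary Groups in Three Variables*, Ann. of Math. Stud. 123 (1990),
  §7.2 Prop. 7.2.1, Prop. 7.2.2 [Rogawski1990].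
* J. Arthur, *The trace formula in invariant form*, Ann. of Math. 114 (1981), §2 [Arthur1981TraceFormulaInvariantForm].
-/

set_option autoImplicit false

noncomputable section

open MeasureTheory MeasureTheory.Measure NumberField IsDedekindDomain Set Polynomial Literature.MeasureTheory.Group
open scoped NNReal ENNReal MatrixGroups Classical
open Literature.NumberTheory.Automorphic.Meyer

namespace Literature.NumberTheory.Automorphic

namespace UnitaryGroup

/-! ## §1 `θ₀ = δ²` is not a square in `F` -/

/-- **`δ² ∈ F` is not a square in `F`** when `c δ = -δ ≠ 0`: if `δ² = r²` with `r ∈ F` then `δ = ± r ∈ F` is fixed by the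
`F`-automorphism `c`, so `δ = -δ`, `δ = 0`. [cite: Rogawski1990, §7.2 (p. 94: `E = F(δ)`)] -/
theorem not_isSquare_of_conj_eq_neg {F E : Type} [Field F] [Field E] [CharZero E] [Algebra F E] {c : E ≃ₐ[F] E}
    {δ : E} (hcδ : c δ = -δ) (hδ : δ ≠ 0) {θ₀ : F} (hd : δ * δ = algebraMap F E θ₀) : ¬ IsSquare θ₀ := by
  rintro ⟨r, hr⟩
  have hsq : δ * δ = algebraMap F E r * algebraMap F E r := by rw [hd, hr, map_mul]
  have hδr : δ = algebraMap F E r ∨ δ = -algebraMap F E r := by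
    have h0 : (δ - algebraMap F E r) * (δ + algebraMap F E r) = 0 := by
      have : (δ - algebraMap F E r) * (δ + algebraMap F E r) = δ * δ - algebraMap F E r * algebraMap F E r := by ring
      rw [this, hsq, sub_self]
    rcases mul_eq_zero.1 h0 with h | h
    · exact Or.inl (sub_eq_zero.1 h)
    · exact Or.inr (eq_neg_of_add_eq_zero_left h)
  have hfix : c δ = δ := by
    rcases hδr with h | h
    · rw [h, AlgEquiv.commutes]
    · rw [h, map_neg, AlgEquiv.commutes]
  rw [hfix] at hcδ
  exact hδ (by
    have h2 : (2 : E) * δ = 0 := by rw [two_mul]; nth_rewrite 2 [hcδ]; exact add_neg_cancel δ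
    rcases mul_eq_zero.1 h2 with h | h
    · exact absurd h two_ne_zero
    · exact h)

/-! ## §2 HEAD: the singular class of the CM unitary group -/

section CM

set_option maxHeartbeats 800000 in
/-- **`J^T_{i♭}(f) = 𝔄 · log T + 𝔅` FOR `T > T₀` (Prop. 7.2.1 + Prop. 7.2.2, CM unitary group `U(3)`).** For a CM field `L`
(`F = L⁺`, `c` = complex conjugation), the singular base point `γ₀ = ι(d(a,b,a))` with `a ≠ b` of norm one, a Haar measure
`ν` of `N(𝔸_F)` with fundamental domain `𝓕` of `N(F)`, an automorphic measure `μ`, a test function `f` whose `[γ₀]`-orbital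
series is integrable on `G(F)∖G(𝔸_F)` (`hS`) and a trace-zero generator `δ` (`δ̄ = -δ ≠ 0`, `δ² = θ₀ ∈ 𝓞_F ∖ 0`): there are
`𝔄, 𝔅 ∈ ℂ` and `T₀` such that the truncated class term of the class `i♭ = ((X-a)²(X-b), Borel)` is `𝔄 log T + 𝔅` for every
`T > T₀`. Internals: `ν_G, μ_B, μ_T, μ_K, μ_X, μ_A, ν_F` Haar, `β` and `w_T` covering weights (★ `exists_isCoveringWeight`),
`𝓕_F` an idele class domain (★ `exists_isIdeleClassDomain`), `μ_Y := θ_* μ_A`.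
[cite: Rogawski1990, §7.2 Prop. 7.2.1, Prop. 7.2.2 (pp. 91–95)] [cite: Arthur1981TraceFormulaInvariantForm, §2] -/
theorem truncatedTraceClass_singular_eq_mul_log_add_cm (L : Type) [Field L] [NumberField L]
    [IsCMField L]
    [MeasurableSpace (AdeleRing (𝓞 L) L)] [BorelSpace (AdeleRing (𝓞 L) L)]
    [MeasurableSpace (adelicUnipotent (↥(maximalRealSubfield L)) L (IsCMField.complexConj L) 3)] [BorelSpace (adelicUnipotent (↥(maximalRealSubfield L)) L (IsCMField.complexConj L) 3)]
    [MeasurableSpace (quasiSplit (↥(maximalRealSubfield L)) L (IsCMField.complexConj L) 3).Adelic] [BorelSpace (quasiSplit (↥(maximalRealSubfield L)) L (IsCMField.complexConj L) 3).Adelic]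
    (hc : (IsCMField.complexConj L) * (IsCMField.complexConj L) = 1)
    {a b : Lˣ} {g₀ : (quasiSplit (↥(maximalRealSubfield L)) L (IsCMField.complexConj L) 3).Rational} {γ₀ : (quasiSplit (↥(maximalRealSubfield L)) L (IsCMField.complexConj L) 3).arithmeticSubgroup}
    (hg₀ : ((g₀.val : GL (Fin 3) L) : Matrix (Fin 3) (Fin 3) L) = !![(a : L), 0, 0; 0, b, 0; 0, 0, a])
    (hγ₀ : (γ₀ : (quasiSplit (↥(maximalRealSubfield L)) L (IsCMField.complexConj L) 3).Adelic) = (quasiSplit (↥(maximalRealSubfield L)) L (IsCMField.complexConj L) 3).toAdelic g₀)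
    (hab : (a : L) ≠ (b : L)) (ha : (IsCMField.complexConj L) (a : L) * (a : L) = 1)
    (hb : (IsCMField.complexConj L) (b : L) * (b : L) = 1)
    {δ : L} (hcδ : (IsCMField.complexConj L) δ = -δ) (hδ : δ ≠ 0) (θ₀ : 𝓞 (↥(maximalRealSubfield L))) (hθ : θ₀ ≠ 0)
    (hd : δ * δ = algebraMap (↥(maximalRealSubfield L)) L (θ₀ : (↥(maximalRealSubfield L))))
    (ν : Measure (adelicUnipotent (↥(maximalRealSubfield L)) L (IsCMField.complexConj L) 3)) [ν.IsHaarMeasure]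
    {𝓕 : Set (adelicUnipotent (↥(maximalRealSubfield L)) L (IsCMField.complexConj L) 3)} (h𝓕 : IsFundamentalDomain (rationalUnipotent (↥(maximalRealSubfield L)) L (IsCMField.complexConj L) 3) 𝓕 ν)
    (μ : Measure (quasiSplit (↥(maximalRealSubfield L)) L (IsCMField.complexConj L) 3).automorphicQuotient) [(quasiSplit (↥(maximalRealSubfield L)) L (IsCMField.complexConj L) 3).IsAutomorphicMeasure μ]
    {f : (quasiSplit (↥(maximalRealSubfield L)) L (IsCMField.complexConj L) 3).Adelic → ℂ} (hf : IsQuasiSplitTest (↥(maximalRealSubfield L)) L (IsCMField.complexConj L) 3 f)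
    (hS : Integrable ((quasiSplit (↥(maximalRealSubfield L)) L (IsCMField.complexConj L) 3).quotFun (fun y : (quasiSplit (↥(maximalRealSubfield L)) L (IsCMField.complexConj L) 3).Adelic => ∑' s : ↥(conjOrbit (quasiSplit (↥(maximalRealSubfield L)) L (IsCMField.complexConj L) 3).arithmeticSubgroup (γ₀ : (quasiSplit (↥(maximalRealSubfield L)) L (IsCMField.complexConj L) 3).Adelic)), f (y⁻¹ * (s : (quasiSplit (↥(maximalRealSubfield L)) L (IsCMField.complexConj L) 3).Adelic) * y))) μ) :
    haveI := t2Space_adeleRing_of_numberField L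
    haveI := locallyCompactSpace_adeleRing' L
    haveI := secondCountableTopology_adeleRing L
    haveI : T2Space (quasiSplit (↥(maximalRealSubfield L)) L (IsCMField.complexConj L) 3).Adelic :=
      inferInstanceAs (T2Space (adelic (↥(maximalRealSubfield L)) L (IsCMField.complexConj L) 3 ((StdForm.antidiagonal 3).over L)))
    haveI : LocallyCompactSpace (quasiSplit (↥(maximalRealSubfield L)) L (IsCMField.complexConj L) 3).Adelic :=
      inferInstanceAs (LocallyCompactSpace (adelic (↥(maximalRealSubfield L)) L (IsCMField.complexConj L) 3 ((StdForm.antidiagonal 3).over L)))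
    haveI : SecondCountableTopology (quasiSplit (↥(maximalRealSubfield L)) L (IsCMField.complexConj L) 3).Adelic :=
      inferInstanceAs (SecondCountableTopology (adelic (↥(maximalRealSubfield L)) L (IsCMField.complexConj L) 3 ((StdForm.antidiagonal 3).over L)))
    haveI : DiscreteTopology (quasiSplit (↥(maximalRealSubfield L)) L (IsCMField.complexConj L) 3).quotientSubgroup := by
      rw [quotientSubgroup_quasiSplit]; exact isDiscreteRational_quasiSplit
    letI := AdelicGroupData.measurableSpaceQuotientForm (quasiSplit (↥(maximalRealSubfield L)) L (IsCMField.complexConj L) 3)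
    haveI := AdelicGroupData.borelSpaceQuotientForm (quasiSplit (↥(maximalRealSubfield L)) L (IsCMField.complexConj L) 3)
    haveI := AdelicGroupData.smulInvariantMeasureQuotientForm (quasiSplit (↥(maximalRealSubfield L)) L (IsCMField.complexConj L) 3) μ
    haveI := AdelicGroupData.isFiniteMeasureOnCompactsQuotientForm (quasiSplit (↥(maximalRealSubfield L)) L (IsCMField.complexConj L) 3) μ
    ∃ 𝔄 𝔅 : ℂ, ∃ T₀ : ℝ≥0, ∀ T : ℝ≥0, T₀ < T →
      truncatedTraceClass μ ν 𝓕 T (fun γ : (quasiSplit (↥(maximalRealSubfield L)) L (IsCMField.complexConj L) 3).arithmeticSubgroup => (((adelicVal (↥(maximalRealSubfield L)) L (IsCMField.complexConj L) 3 _ (γ : (quasiSplit (↥(maximalRealSubfield L)) L (IsCMField.complexConj L) 3).Adelic) :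
          GL (Fin 3) (AdeleRing (𝓞 L) L)) : Matrix (Fin 3) (Fin 3) (AdeleRing (𝓞 L) L)).charpoly,
        decide (∃ δ : (quasiSplit (↥(maximalRealSubfield L)) L (IsCMField.complexConj L) 3).arithmeticSubgroup, δ * γ * δ⁻¹ ∈ arithmeticBorel (↥(maximalRealSubfield L)) L (IsCMField.complexConj L) 3))) ((Polynomial.map (algebraMap L (AdeleRing (𝓞 L) L)) ((X - C (a : L)) ^ 2 * (X - C (b : L)))), true) f =
        𝔄 * ((Real.log (T : ℝ) : ℝ) : ℂ) + 𝔅 := by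
  classical
  haveI := t2Space_adeleRing_of_numberField L
  haveI := locallyCompactSpace_adeleRing' L
  haveI := secondCountableTopology_adeleRing L
  haveI := locallyCompactSpace_adeleRing' (↥(maximalRealSubfield L))
  haveI : T2Space (quasiSplit (↥(maximalRealSubfield L)) L (IsCMField.complexConj L) 3).Adelic :=
    inferInstanceAs (T2Space (adelic (↥(maximalRealSubfield L)) L (IsCMField.complexConj L) 3 ((StdForm.antidiagonal 3).over L)))
  haveI : LocallyCompactSpace (quasiSplit (↥(maximalRealSubfield L)) L (IsCMField.complexConj L) 3).Adelic :=
    inferInstanceAs (LocallyCompactSpace (adelic (↥(maximalRealSubfield L)) L (IsCMField.complexConj L) 3 ((StdForm.antidiagonal 3).over L)))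
  haveI : SecondCountableTopology (quasiSplit (↥(maximalRealSubfield L)) L (IsCMField.complexConj L) 3).Adelic :=
    inferInstanceAs (SecondCountableTopology (adelic (↥(maximalRealSubfield L)) L (IsCMField.complexConj L) 3 ((StdForm.antidiagonal 3).over L)))
  haveI : DiscreteTopology (quasiSplit (↥(maximalRealSubfield L)) L (IsCMField.complexConj L) 3).quotientSubgroup := by
    rw [quotientSubgroup_quasiSplit]; exact isDiscreteRational_quasiSplit
  letI := AdelicGroupData.measurableSpaceQuotientForm (quasiSplit (↥(maximalRealSubfield L)) L (IsCMField.complexConj L) 3)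
  haveI := AdelicGroupData.borelSpaceQuotientForm (quasiSplit (↥(maximalRealSubfield L)) L (IsCMField.complexConj L) 3)
  haveI := AdelicGroupData.smulInvariantMeasureQuotientForm (quasiSplit (↥(maximalRealSubfield L)) L (IsCMField.complexConj L) 3) μ
  haveI := AdelicGroupData.isFiniteMeasureOnCompactsQuotientForm (quasiSplit (↥(maximalRealSubfield L)) L (IsCMField.complexConj L) 3) μ
  -- measurable structures chosen inside: `𝔸_F`, `𝕀_F`
  letI : MeasurableSpace (AdeleRing (𝓞 (↥(maximalRealSubfield L))) (↥(maximalRealSubfield L))) := borel _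
  haveI : BorelSpace (AdeleRing (𝓞 (↥(maximalRealSubfield L))) (↥(maximalRealSubfield L))) := ⟨rfl⟩
  letI : MeasurableSpace (GaloisRepresentations.ideleGroup (↥(maximalRealSubfield L))) := borel _
  haveI : BorelSpace (GaloisRepresentations.ideleGroup (↥(maximalRealSubfield L))) := ⟨rfl⟩
  haveI := locallyCompactSpace_ideleGroup (↥(maximalRealSubfield L))
  -- structure on `B(𝔸)`, `T(𝔸)`, `K_U`, `𝔸_E⁻`
  haveI : BorelSpace (borelAdelic (↥(maximalRealSubfield L)) L (IsCMField.complexConj L) 3) := Subtype.borelSpace _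
  haveI : LocallyCompactSpace (borelAdelic (↥(maximalRealSubfield L)) L (IsCMField.complexConj L) 3) := locallyCompactSpace_borelAdelic
  haveI : SecondCountableTopology (borelAdelic (↥(maximalRealSubfield L)) L (IsCMField.complexConj L) 3) := secondCountableTopology_borelAdelic
  haveI : T2Space (borelAdelic (↥(maximalRealSubfield L)) L (IsCMField.complexConj L) 3) := t2Space_borelAdelic
  haveI : BorelSpace (torusInBorel (↥(maximalRealSubfield L)) L (IsCMField.complexConj L) 3) := Subtype.borelSpace _
  haveI : LocallyCompactSpace (torusInBorel (↥(maximalRealSubfield L)) L (IsCMField.complexConj L) 3) :=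
    (isTopSemidirect_borelAdelic (F := (↥(maximalRealSubfield L))) (E := L) (c := (IsCMField.complexConj L)) (N := 3)).isClosed_left.locallyCompactSpace
  haveI : SecondCountableTopology (torusInBorel (↥(maximalRealSubfield L)) L (IsCMField.complexConj L) 3) := TopologicalSpace.Subtype.secondCountableTopology _
  haveI : BorelSpace ↥((standardMaximalCompactGL 3 L).comap (adelicVal (↥(maximalRealSubfield L)) L (IsCMField.complexConj L) 3 ((StdForm.antidiagonal 3).over L)) : Subgroup (quasiSplit (↥(maximalRealSubfield L)) L (IsCMField.complexConj L) 3).Adelic) := Subtype.borelSpace _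
  haveI : CompactSpace ↥((standardMaximalCompactGL 3 L).comap (adelicVal (↥(maximalRealSubfield L)) L (IsCMField.complexConj L) 3 ((StdForm.antidiagonal 3).over L)) : Subgroup (quasiSplit (↥(maximalRealSubfield L)) L (IsCMField.complexConj L) 3).Adelic) := isCompact_iff_compactSpace.1 isCompact_comap_adelicVal_standardMaximalCompactGL
  haveI : SecondCountableTopology ↥((standardMaximalCompactGL 3 L).comap (adelicVal (↥(maximalRealSubfield L)) L (IsCMField.complexConj L) 3 ((StdForm.antidiagonal 3).over L)) : Subgroup (quasiSplit (↥(maximalRealSubfield L)) L (IsCMField.complexConj L) 3).Adelic) := TopologicalSpace.Subtype.secondCountableTopology _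
  haveI := locallyCompactSpace_traceZeroAdele (F := (↥(maximalRealSubfield L))) (E := L) (c := (IsCMField.complexConj L))
  haveI : SecondCountableTopology (traceZeroAdele (↥(maximalRealSubfield L)) L (IsCMField.complexConj L)) := TopologicalSpace.Subtype.secondCountableTopology _
  haveI : BorelSpace (traceZeroAdele (↥(maximalRealSubfield L)) L (IsCMField.complexConj L)) := Subtype.borelSpace _
  haveI := discreteTopology_subgroupOf_torusInBorel (F := (↥(maximalRealSubfield L))) (E := L) (c := (IsCMField.complexConj L)) (N := 3)
  -- CM facts
  have hc1 : (IsCMField.complexConj L) ≠ 1 := IsCMField.complexConj_ne_one L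
  have hBK := exists_mem_borelAdelic_mul_mem_standardMaximalCompactGL_cm_three L
  have hsq : ¬ IsSquare ((θ₀ : 𝓞 (↥(maximalRealSubfield L))) : (↥(maximalRealSubfield L))) := not_isSquare_of_conj_eq_neg hcδ hδ hd
  -- the Haar measures
  obtain ⟨K₀⟩ := (inferInstance : Nonempty (TopologicalSpace.PositiveCompacts (AdeleRing (𝓞 L) L)))
  obtain ⟨K₁⟩ := (inferInstance : Nonempty (TopologicalSpace.PositiveCompacts (AdeleRing (𝓞 (↥(maximalRealSubfield L))) (↥(maximalRealSubfield L)))))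
  set μX : Measure (AdeleRing (𝓞 L) L) := Measure.addHaarMeasure K₀ with hμX
  set μA : Measure (AdeleRing (𝓞 (↥(maximalRealSubfield L))) (↥(maximalRealSubfield L))) := Measure.addHaarMeasure K₁ with hμA
  set νG : Measure (quasiSplit (↥(maximalRealSubfield L)) L (IsCMField.complexConj L) 3).Adelic := Measure.haar with hνG
  set μB : Measure (borelAdelic (↥(maximalRealSubfield L)) L (IsCMField.complexConj L) 3) := Measure.haar with hμB
  set μT : Measure (torusInBorel (↥(maximalRealSubfield L)) L (IsCMField.complexConj L) 3) := Measure.haar with hμT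
  set μK : Measure ↥((standardMaximalCompactGL 3 L).comap (adelicVal (↥(maximalRealSubfield L)) L (IsCMField.complexConj L) 3 ((StdForm.antidiagonal 3).over L)) : Subgroup (quasiSplit (↥(maximalRealSubfield L)) L (IsCMField.complexConj L) 3).Adelic) := Measure.haar with hμK
  set νF : Measure (GaloisRepresentations.ideleGroup (↥(maximalRealSubfield L))) := Measure.haar with hνF
  -- the centre measure `μ_Y := θ_* μ_A`
  haveI hμY : (μA.map (traceZeroLine (↥(maximalRealSubfield L)) L (IsCMField.complexConj L) hcδ hδ)).IsAddHaarMeasure :=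
    (traceZeroLine (↥(maximalRealSubfield L)) L (IsCMField.complexConj L) hcδ hδ).isAddHaarMeasure_map μA
  haveI : (μA.map (traceZeroLine (↥(maximalRealSubfield L)) L (IsCMField.complexConj L) hcδ hδ)).Regular := Regular.map (traceZeroLine (↥(maximalRealSubfield L)) L (IsCMField.complexConj L) hcδ hδ).toHomeomorph
  -- the covering weights and the idele class domain
  haveI : DiscreteTopology ↥((arithmeticBorel (↥(maximalRealSubfield L)) L (IsCMField.complexConj L) 3 ⊓ Subgroup.centralizer ({γ₀} : Set (quasiSplit (↥(maximalRealSubfield L)) L (IsCMField.complexConj L) 3).arithmeticSubgroup)).map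
      (quasiSplit (↥(maximalRealSubfield L)) L (IsCMField.complexConj L) 3).arithmeticSubgroup.subtype) :=
    DiscreteTopology.of_subset (isDiscreteRational_quasiSplit : DiscreteTopology (quasiSplit (↥(maximalRealSubfield L)) L (IsCMField.complexConj L) 3).arithmeticSubgroup)
      (show ((((arithmeticBorel (↥(maximalRealSubfield L)) L (IsCMField.complexConj L) 3 ⊓ Subgroup.centralizer ({γ₀} : Set (quasiSplit (↥(maximalRealSubfield L)) L (IsCMField.complexConj L) 3).arithmeticSubgroup)).map
        (quasiSplit (↥(maximalRealSubfield L)) L (IsCMField.complexConj L) 3).arithmeticSubgroup.subtype : Subgroup (quasiSplit (↥(maximalRealSubfield L)) L (IsCMField.complexConj L) 3).Adelic) : Set (quasiSplit (↥(maximalRealSubfield L)) L (IsCMField.complexConj L) 3).Adelic) ⊆ ((quasiSplit (↥(maximalRealSubfield L)) L (IsCMField.complexConj L) 3).arithmeticSubgroup : Set (quasiSplit (↥(maximalRealSubfield L)) L (IsCMField.complexConj L) 3).Adelic)) from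
        fun x hx => Subgroup.map_subtype_le _ hx)
  obtain ⟨β, hβ⟩ := exists_isCoveringWeight ((arithmeticBorel (↥(maximalRealSubfield L)) L (IsCMField.complexConj L) 3 ⊓
    Subgroup.centralizer ({γ₀} : Set (quasiSplit (↥(maximalRealSubfield L)) L (IsCMField.complexConj L) 3).arithmeticSubgroup)).map (quasiSplit (↥(maximalRealSubfield L)) L (IsCMField.complexConj L) 3).arithmeticSubgroup.subtype)
  obtain ⟨wT, hwT⟩ := exists_isCoveringWeight_torusInBorel (F := (↥(maximalRealSubfield L))) (E := L) (c := (IsCMField.complexConj L)) (N := 3)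
  obtain ⟨𝓕F, h𝓕F⟩ := exists_isIdeleClassDomain (↥(maximalRealSubfield L))
  -- the `X`-side unfolding (★ F0P3a-p02) and the `G(𝔸)`-side value (★ A-p14)
  obtain ⟨T₀, hX⟩ := truncatedTraceClass_singular_eq_integral_add_mul_integral_singularBracket_cm L hc hg₀ hγ₀ hab ha hb ν h𝓕 μ
    νG (μA.map (traceZeroLine (↥(maximalRealSubfield L)) L (IsCMField.complexConj L) hcδ hδ)) hf hβ hS
  obtain ⟨Cst, hCst, 𝔅', hG⟩ := exists_integral_weight_smul_singularBracket_eq_mul_log_add (F := (↥(maximalRealSubfield L))) (E := L) (c := (IsCMField.complexConj L))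
    hc hc1 hab hg₀ hγ₀ hcδ hδ θ₀ hθ hd hsq hf hBK νG μB μT μK μX μA νF h𝓕F hβ hwT
  refine ⟨((unfoldingConstant (quasiSplit (↥(maximalRealSubfield L)) L (IsCMField.complexConj L) 3).quotientSubgroup (count : Measure (quasiSplit (↥(maximalRealSubfield L)) L (IsCMField.complexConj L) 3).quotientSubgroup) μ νG : ℝ) : ℂ) *
      ((Cst : ℂ) * ((((μA.map (traceZeroLine (↥(maximalRealSubfield L)) L (IsCMField.complexConj L) hcδ hδ)).real (traceZeroFundamentalDomain (↥(maximalRealSubfield L)) L (IsCMField.complexConj L)) : ℝ) : ℂ) *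
        ((1 / 2 : ℂ) * (((idelicCovolume (↥(maximalRealSubfield L)) νF).toReal : ℂ) *
          (((μA (adeleFundamentalDomain (↥(maximalRealSubfield L)))).toReal⁻¹ : ℂ) * adeleFourier (↥(maximalRealSubfield L)) μA
            (fun s : AdeleRing (𝓞 (↥(maximalRealSubfield L))) (↥(maximalRealSubfield L)) =>
              ∫ x : AdeleRing (𝓞 L) L, (∫ k : ↥((standardMaximalCompactGL 3 L).comap (adelicVal (↥(maximalRealSubfield L)) L (IsCMField.complexConj L) 3 ((StdForm.antidiagonal 3).over L)) : Subgroup (quasiSplit (↥(maximalRealSubfield L)) L (IsCMField.complexConj L) 3).Adelic), f ((k : (quasiSplit (↥(maximalRealSubfield L)) L (IsCMField.complexConj L) 3).Adelic)⁻¹ *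
                (((((heisElt hc x (0 : traceZeroAdele (↥(maximalRealSubfield L)) L (IsCMField.complexConj L)) : unipotentInBorel (↥(maximalRealSubfield L)) L (IsCMField.complexConj L) 3) :
                      borelAdelic (↥(maximalRealSubfield L)) L (IsCMField.complexConj L) 3) : (quasiSplit (↥(maximalRealSubfield L)) L (IsCMField.complexConj L) 3).Adelic))⁻¹ *
                  ((γ₀ : (quasiSplit (↥(maximalRealSubfield L)) L (IsCMField.complexConj L) 3).Adelic) * (((heisElt hc 0 (traceZeroLine (↥(maximalRealSubfield L)) L (IsCMField.complexConj L) hcδ hδ s) :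
                      unipotentInBorel (↥(maximalRealSubfield L)) L (IsCMField.complexConj L) 3) : borelAdelic (↥(maximalRealSubfield L)) L (IsCMField.complexConj L) 3) : (quasiSplit (↥(maximalRealSubfield L)) L (IsCMField.complexConj L) 3).Adelic)) *
                  (((heisElt hc x (0 : traceZeroAdele (↥(maximalRealSubfield L)) L (IsCMField.complexConj L)) : unipotentInBorel (↥(maximalRealSubfield L)) L (IsCMField.complexConj L) 3) :
                      borelAdelic (↥(maximalRealSubfield L)) L (IsCMField.complexConj L) 3) : (quasiSplit (↥(maximalRealSubfield L)) L (IsCMField.complexConj L) 3).Adelic)) * (k : (quasiSplit (↥(maximalRealSubfield L)) L (IsCMField.complexConj L) 3).Adelic)) ∂μK) ∂μX) 0))))),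
    (∫ x, (quasiSplit (↥(maximalRealSubfield L)) L (IsCMField.complexConj L) 3).quotFun (fun y : (quasiSplit (↥(maximalRealSubfield L)) L (IsCMField.complexConj L) 3).Adelic => ∑' s : ↥(conjOrbit (quasiSplit (↥(maximalRealSubfield L)) L (IsCMField.complexConj L) 3).arithmeticSubgroup (γ₀ : (quasiSplit (↥(maximalRealSubfield L)) L (IsCMField.complexConj L) 3).Adelic)), f (y⁻¹ * (s : (quasiSplit (↥(maximalRealSubfield L)) L (IsCMField.complexConj L) 3).Adelic) * y)) x ∂μ) +
      ((unfoldingConstant (quasiSplit (↥(maximalRealSubfield L)) L (IsCMField.complexConj L) 3).quotientSubgroup (count : Measure (quasiSplit (↥(maximalRealSubfield L)) L (IsCMField.complexConj L) 3).quotientSubgroup) μ νG : ℝ) : ℂ) * 𝔅',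
    T₀, fun T hT => ?_⟩
  have hT0 : 0 < (T : ℝ) := lt_of_le_of_lt T₀.2 (by exact_mod_cast hT)
  rw [hX T hT, hG T hT0]
  ring

end CM

end UnitaryGroup

end Literature.NumberTheory.Automorphic
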